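import Summits.Ventures.CertifiedArithmetic.LowPrec.DoubleRoundingFMAWindowB

/-!
# Equal precision: a deeper subnormal range is never innocuous for the FMA (THEOREM N-fma-E)

HONEST FRAMING: certified error envelopes and provably optimal rounding/accumulation schemes for
low-precision formats under stated cost models; every table by two implementations; no hardware
or vendor claims.

`DFma φ ψ` (`DoubleRoundingFMAMatrix.lean`): ONE fused multiply-add of `φ`-data executed in the
wide format `ψ` and converted to `φ` is the correctly rounded FMA of `φ`.  THEOREMS N-fma-A / B
(`DoubleRoundingFMAWindowA/B.lean`) explain every failing cell `X ⊆ Y` of the named matrix with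
`P_X < P_Y`.  The remaining failing embedded cells have EQUAL PRECISION: `Y` has the digits of `X`
and a finer quantum (a deeper subnormal range), e.g. e3m2 ⊆ e5m2, e2m3 ⊆ e4m3.  There `Y` is never
finer than `X` on the normal range of `X`, so a double-rounding slip can only sit at a SUBNORMAL
midpoint of `X` — and it always does:

THEOREM N-fma-E (`not_dFma_of_equal_precision`, every pair of records).  Let `F_φ ⊆ F_ψ` with
`quantum ψ ∣ quantum φ`, `quantum ψ < quantum φ`, the finite range of `φ` inside that of `ψ`,
`m_ψ = m_φ = m ≥ 2`, `1 ≤ bias φ`, `bias φ + m ≥ 4`, and `2^(m+1)`, `2^(bias φ + m - 4)` quanta in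
range.  Then `¬ DFma φ ψ`, by the triple (in quanta `q` of `φ`)
  `a = 5`,  `b = 2^(bias φ + m - 4)` (so that `a·b = 5/8`),  `c = j := 2^(m-1)` (a subnormal datum):
`a·b + c = j + 5/8`.  In `ψ` the point `v = j + 1/2 = (2j+1)/2` is a value with a full `P`-bit
significand `2j + 1 = 2^m + 1`, so the spacing of `ψ` just above `v` is `1/2` and
`fl_ψ(j + 5/8) = v` (`toRat_roundNE_full_add_small`); in `φ`, `v` is the midpoint of the
subnormal data `j`, `j + 1` and resolves to the EVEN one, `j` (`toRat_roundNE_half_of_even`), while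
`fl_φ(j + 5/8) = j + 1` (`toRat_roundNE_natMul_add_small`).  The core is the slip lemma
`roundNE_roundNE_ne_half` for any even `j` with `2^m ≤ 2j + 1 < 2^(m+1)`.

On the named `13 × 13` matrix the hypothesis holds on exactly the `7` equal-precision failing
cells (`dFmaEqualPrecision_named_iff`, `decide +kernel`): e3m2 → e5m2 / binary8p3 / binary8p3f,
e2m3 → e4m3 / binary8p4 / binary8p4f, e5m2 → binary8p3f; so together with THEOREMS N-fma-A
(`22` cells) and N-fma-B (`19` cells) EVERY one of the `40` failing embedded cells of
`dFma_named_iff` is an instance of one of three record-generic laws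
(`dFma_named_failing_classified`, `not_dFma_named_of_laws`), as the `27` holding cells are
instances of clauses (I)/(G)/(F) (`dFma_of_test`).  For comparison: with equal precision SUMS
double-round correctly for any nested quanta (`drAdd_of_manBits_eq`); the fused operation does
not, because the exact product contributes the odd eighth of a quantum.

References: [BoldoMelquiond2008] (double rounding and the FMA); [MartinDorelMelquiondMuller2013,
Property 2.1] (slips sit at midpoints); [Figueroa1995, §3], [Roux2014, §2] (innocuous double
rounding of the basic operations needs `emin` conditions once subnormals are present — Roux's
`emin₂ ≤ 2·emin₁`-type hypotheses; here the phenomenon isolated for the fused operation);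
implementation A `code/enum/fma_equal_law.py` → `certs/enum/DOUBLE-ROUNDING-FMA-EQUAL.json`.
-/

namespace Summit.Ventures.CertifiedArithmetic

open Literature.ComputerArithmetic.FloatingPoint
open Literature.ComputerArithmetic.FloatingPoint.Format
open Literature.ComputerArithmetic.FloatingPoint.MiniFloat

/-! ## §1 Rounding near the integer grid and near a full-width value -/

/-- INTEGRALITY OF THE VALUE GRID: every datum is an integer number of quanta. [folklore] -/
theorem exists_toRat_eq_int_mul {φ : Format} (z : MiniFloat φ) :
    ∃ T : ℤ, z.toRat = (T : ℚ) * φ.quantum := ⟨z.toInt, rfl⟩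

/-- A VALUE PLUS LESS THAN HALF A QUANTUM rounds back to the value: for a representable
`t` quanta and `2|ε| < quantum`, `fl_φ (t·q + ε) = t·q` (no other datum is as near, by
integrality of the grid). [folklore] -/
theorem toRat_roundNE_natMul_add_small {φ : Format} {t : ℕ} (ht : φ.Representable t) {ε : ℚ}
    (hε : 2 * |ε| < φ.quantum) :
    (roundNE φ ((t : ℚ) * φ.quantum + ε)).toRat = (t : ℚ) * φ.quantum := by
  have hq := φ.quantum_pos
  obtain ⟨z, hz⟩ := exists_toRat_eq_natMul ht
  set x := (t : ℚ) * φ.quantum + ε with hx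
  have hnear := roundNE_nearest (φ := φ) x z
  rw [hz, show x - (t : ℚ) * φ.quantum = ε by rw [hx]; ring] at hnear
  obtain ⟨T, hT⟩ := exists_toRat_eq_int_mul (roundNE φ x)
  rw [hT] at hnear ⊢
  have h1 : |((t : ℤ) : ℚ) - T| * φ.quantum ≤ 2 * |ε| := by
    have e1 : (((t : ℤ) : ℚ) - T) * φ.quantum = (x - (T : ℚ) * φ.quantum) - ε := by
      rw [hx]; push_cast; ring
    rw [← abs_of_pos hq, ← abs_mul, e1]
    calc |x - (T : ℚ) * φ.quantum - ε| ≤ |x - (T : ℚ) * φ.quantum| + |ε| := abs_sub _ _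
      _ ≤ |ε| + |ε| := by linarith
      _ = 2 * |ε| := by ring
  have h2 : |((t : ℤ) : ℚ) - T| < 1 := by
    by_contra hge
    push Not at hge
    have : φ.quantum ≤ |((t : ℤ) : ℚ) - T| * φ.quantum := le_mul_of_one_le_left hq.le hge
    linarith
  have h3 : ((t : ℤ) - T : ℤ) = 0 := by
    rw [← Int.abs_lt_one_iff]
    exact_mod_cast h2
  rw [show T = (t : ℤ) by omega]
  push_cast
  ring

/-- THE MIDPOINT OF TWO CONSECUTIVE MULTIPLES OF THE QUANTUM resolves to the even one: for an
even `j` with `j + 1 < 2^(m+1)` (both `j`, `j + 1` are data — subnormal, or in the first normal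
binade) and `j + 1 ≤ M_φ`, `fl_φ ((j + 1/2)·q) = j·q`.  (The odd neighbour `j + 1` is equally
near; ties-to-even.) [folklore] -/
theorem toRat_roundNE_half_of_even {φ : Format} (h1 : 1 ≤ φ.manBits) {j : ℕ} (hj : Even j)
    (hj1 : j + 1 < 2 ^ (φ.manBits + 1)) (hju : j + 1 ≤ φ.maxScaled) :
    (roundNE φ (((2 * j + 1 : ℕ) : ℚ) / 2 * φ.quantum)).toRat = (j : ℚ) * φ.quantum := by
  have hq := φ.quantum_pos
  obtain ⟨z0, hz0⟩ :=
    exists_toRat_eq_natMul (representable_of_lt_pow (φ := φ) (n := j) (by omega) (by omega))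
  set x := ((2 * j + 1 : ℕ) : ℚ) / 2 * φ.quantum with hx
  have ex0 : x - z0.toRat = φ.quantum / 2 := by rw [hx, hz0]; push_cast; ring
  have hnear := roundNE_nearest (φ := φ) x z0
  rw [ex0, abs_of_pos (half_pos hq)] at hnear
  obtain ⟨T, hT⟩ := exists_toRat_eq_int_mul (roundNE φ x)
  have hTj : T = j ∨ T = j + 1 := by
    rw [hT] at hnear
    have e1 : x - (T : ℚ) * φ.quantum = (((2 * j + 1 : ℕ) : ℚ) / 2 - T) * φ.quantum := by
      rw [hx]; ring
    rw [e1, abs_mul, abs_of_pos hq] at hnear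
    have h' : |((2 * j + 1 : ℕ) : ℚ) / 2 - T| ≤ 1 / 2 := by
      by_contra hc
      push Not at hc
      nlinarith
    rw [abs_le] at h'
    push_cast at h'
    have hlo : (j : ℚ) ≤ T := by linarith [h'.2]
    have hhi : (T : ℚ) ≤ j + 1 := by linarith [h'.1]
    have hlo' : (j : ℤ) ≤ T := by exact_mod_cast hlo
    have hhi' : T ≤ (j : ℤ) + 1 := by exact_mod_cast hhi
    omega
  rcases hTj with rfl | rfl
  · rw [hT]; push_cast; ring
  · exfalso
    have hr1 : (roundNE φ x).toRat = ((j + 1 : ℕ) : ℚ) * φ.quantum := by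
      rw [hT]; push_cast; ring
    have hev : 2 ∣ (roundNE φ x).man := by
      refine roundNE_man_even_of_tie h1 (y := z0) ?_ ?_
      · rw [ex0, hr1, show x - ((j + 1 : ℕ) : ℚ) * φ.quantum = -(φ.quantum / 2) by
          rw [hx]; push_cast; ring, abs_neg]
      · rw [hz0, hr1]
        push_cast
        intro h
        have := mul_right_cancel₀ hq.ne' h
        linarith
    rw [two_dvd_man_iff h1, scaledMag_eq_of_toRat_eq hr1] at hev
    have h2 : 2 ∣ j + 1 := dvd_trans (Dvd.intro _ rfl) hev
    obtain ⟨c, hc⟩ := hj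
    omega

/-- THE GAP ABOVE A FULL-WIDTH VALUE: a representable magnitude strictly above `s·2^e` quanta,
`2^m ≤ s`, is at least `(s + 1)·2^e` quanta (values above `2^(m+e)` are multiples of `2^e`).
[folklore] -/
theorem le_of_representable_gt_full {ψ : Format} {s e n : ℕ} (hs : 2 ^ ψ.manBits ≤ s)
    (hn : ψ.Representable n) (hlt : s * 2 ^ e < n) : (s + 1) * 2 ^ e ≤ n := by
  obtain ⟨-, k, i, hk, rfl⟩ := representable_iff.mp hn
  rcases le_or_gt e i with hei | hie
  · obtain ⟨d, rfl⟩ := Nat.exists_eq_add_of_le hei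
    have e1 : k * 2 ^ (e + d) = (k * 2 ^ d) * 2 ^ e := by rw [pow_add]; ring
    rw [e1] at hlt ⊢
    have h2 : s < k * 2 ^ d := Nat.lt_of_mul_lt_mul_right hlt
    exact Nat.mul_le_mul_right _ (by omega)
  · exfalso
    have h2 : k * 2 ^ i < 2 ^ (ψ.manBits + 1) * 2 ^ i :=
      Nat.mul_lt_mul_of_pos_right hk (by positivity)
    have h3 : 2 ^ (ψ.manBits + 1) * 2 ^ i ≤ 2 ^ ψ.manBits * 2 ^ e := by
      rw [← pow_add, ← pow_add]
      exact Nat.pow_le_pow_right (by norm_num) (by omega)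
    have h4 : 2 ^ ψ.manBits * 2 ^ e ≤ s * 2 ^ e := Nat.mul_le_mul_right _ hs
    omega

/-- JUST ABOVE A FULL-WIDTH VALUE ROUNDS DOWN TO IT: for `2^m ≤ s < 2^(m+1)` and
`s·2^e ≤ M_ψ`, `fl_ψ (s·2^e·q + δ) = s·2^e·q` whenever `0 ≤ 2δ < 2^e·q` (the spacing of `ψ`
above the value is `2^e` quanta). [folklore] -/
theorem toRat_roundNE_full_add_small {ψ : Format} {s e : ℕ} (hs : 2 ^ ψ.manBits ≤ s)
    (hs' : s < 2 ^ (ψ.manBits + 1)) (hu : s * 2 ^ e ≤ ψ.maxScaled) {δ : ℚ} (hδ0 : 0 ≤ δ)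
    (hδ : 2 * δ < 2 ^ e * ψ.quantum) :
    (roundNE ψ (((s * 2 ^ e : ℕ) : ℚ) * ψ.quantum + δ)).toRat
      = ((s * 2 ^ e : ℕ) : ℚ) * ψ.quantum := by
  have hq := ψ.quantum_pos
  obtain ⟨z, hz⟩ := exists_toRat_eq_natMul (representable_mul_pow hs' hu)
  set v := ((s * 2 ^ e : ℕ) : ℚ) * ψ.quantum with hv
  set x := v + δ with hx
  have hnear := roundNE_nearest (φ := ψ) x z
  rw [hz, show x - v = δ by rw [hx]; ring, abs_of_nonneg hδ0] at hnear
  have hlo : v ≤ (roundNE ψ x).toRat := by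
    have := (abs_le.mp hnear).2; rw [hx] at this; linarith
  have hhi : (roundNE ψ x).toRat ≤ v + 2 * δ := by
    have := (abs_le.mp hnear).1; rw [hx] at this; linarith
  rcases eq_or_lt_of_le hlo with h | h
  · exact h.symm
  · exfalso
    have hv0 : 0 ≤ v := by rw [hv]; positivity
    have hr0 : 0 ≤ (roundNE ψ x).toRat := le_trans hv0 hlo
    have hmag : (roundNE ψ x).toRat = ((roundNE ψ x).scaledMag : ℚ) * ψ.quantum := by
      rw [← abs_of_nonneg hr0, abs_toRat]
    have hlt : s * 2 ^ e < (roundNE ψ x).scaledMag := by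
      rw [hmag, hv] at h
      exact_mod_cast lt_of_mul_lt_mul_right h hq.le
    have hge := le_of_representable_gt_full hs (representable_scaledMag _) hlt
    have h5 : (((s + 1) * 2 ^ e : ℕ) : ℚ) * ψ.quantum ≤ (roundNE ψ x).toRat := by
      rw [hmag]; exact mul_le_mul_of_nonneg_right (by exact_mod_cast hge) hq.le
    rw [hv] at hhi
    push_cast at h5 hhi
    nlinarith

/-! ## §2 The slip at a subnormal midpoint and THEOREM N-fma-E -/

/-- THE EQUAL-PRECISION SLIP: `quantum ψ < quantum φ`, ranges nested, `m_ψ = m_φ = m ≥ 1`; for an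
even `j` with `2^m ≤ 2j + 1 < 2^(m+1)` (so `v = (2j+1)/2` quanta is a value of `ψ` with a full
significand, and the midpoint of the data `j`, `j + 1` of `φ`) and `j + 1 ≤ M_φ`, the rational
`x = (j + 5/8)·q` double-rounds wrongly: `fl_ψ x = v`, `fl_φ v = j·q`, `fl_φ x = (j+1)·q`.
[this packet] -/
theorem roundNE_roundNE_ne_half {φ ψ : Format} (hq : ψ.qexp + 1 ≤ φ.qexp)
    (hM : φ.maxScaled * 2 ^ (φ.qexp - ψ.qexp).toNat ≤ ψ.maxScaled)
    (hm : ψ.manBits = φ.manBits) (h1 : 1 ≤ φ.manBits) {j : ℕ} (hj : Even j)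
    (hjlo : 2 ^ φ.manBits ≤ 2 * j + 1) (hjhi : 2 * j + 1 < 2 ^ (φ.manBits + 1))
    (hju : j + 1 ≤ φ.maxScaled) :
    (roundNE φ (roundNE ψ (((8 * j + 5 : ℕ) : ℚ) / 8 * φ.quantum)).toRat).toRat
      ≠ (roundNE φ (((8 * j + 5 : ℕ) : ℚ) / 8 * φ.quantum)).toRat := by
  have hq0 := φ.quantum_pos
  have hq1 := ψ.quantum_pos
  obtain ⟨d, hd⟩ : ∃ d, (φ.qexp - ψ.qexp).toNat = d + 1 := ⟨(φ.qexp - ψ.qexp).toNat - 1, by omega⟩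
  have hQ : φ.quantum = 2 ^ (d + 1) * ψ.quantum := by
    rw [← hd]; exact quantum_eq_two_pow_mul (by omega)
  rw [hd] at hM
  have hv : ((2 * j + 1 : ℕ) : ℚ) / 2 * φ.quantum
      = (((2 * j + 1) * 2 ^ d : ℕ) : ℚ) * ψ.quantum := by
    rw [hQ, pow_succ]; push_cast; ring
  have hx : ((8 * j + 5 : ℕ) : ℚ) / 8 * φ.quantum
      = (((2 * j + 1) * 2 ^ d : ℕ) : ℚ) * ψ.quantum + φ.quantum / 8 := by
    rw [← hv]; push_cast; ring
  -- fl_ψ x = v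
  have hY : (roundNE ψ (((8 * j + 5 : ℕ) : ℚ) / 8 * φ.quantum)).toRat
      = ((2 * j + 1 : ℕ) : ℚ) / 2 * φ.quantum := by
    rw [hx, hv]
    refine toRat_roundNE_full_add_small (by rw [hm]; exact hjlo) (by rw [hm]; exact hjhi) ?_
      (by positivity) ?_
    · calc (2 * j + 1) * 2 ^ d ≤ (2 * j + 2) * 2 ^ d := Nat.mul_le_mul_right _ (by omega)
        _ = (j + 1) * 2 ^ (d + 1) := by rw [pow_succ]; ring
        _ ≤ φ.maxScaled * 2 ^ (d + 1) := Nat.mul_le_mul_right _ hju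
        _ ≤ ψ.maxScaled := hM
    · rw [hQ, pow_succ]
      have h2 : (0 : ℚ) < 2 ^ d * ψ.quantum := by positivity
      nlinarith
  -- fl_φ v = j·q and fl_φ x = (j+1)·q
  have hX1 := toRat_roundNE_half_of_even h1 hj (by omega) hju
  have hX2 : (roundNE φ (((8 * j + 5 : ℕ) : ℚ) / 8 * φ.quantum)).toRat
      = ((j + 1 : ℕ) : ℚ) * φ.quantum := by
    have e1 : ((8 * j + 5 : ℕ) : ℚ) / 8 * φ.quantum
        = ((j + 1 : ℕ) : ℚ) * φ.quantum + (-(3 / 8) * φ.quantum) := by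
      push_cast; ring
    rw [e1]
    refine toRat_roundNE_natMul_add_small (representable_of_lt_pow (by omega) hju) ?_
    rw [abs_of_neg (by linarith)]
    linarith
  rw [hY, hX1, hX2]
  push_cast
  intro h
  have := mul_right_cancel₀ hq0.ne' h
  linarith

/-- THEOREM N-fma-E (equal precision: a deeper subnormal range is never innocuous for the FMA),
for EVERY pair of format records: `quantum ψ ∣ quantum φ` with `quantum ψ < quantum φ`, the
finite range of `φ` inside that of `ψ`, `m_ψ = m_φ = m ≥ 2`, `1 ≤ bias φ`, `bias φ + m ≥ 4`, and
`2^(m+1)`, `2^(bias φ + m - 4)` quanta in range `⟹ ¬ DFma φ ψ`, by the data `a = 5`,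
`b = 2^(bias φ + m - 4)`, `c = 2^(m-1)` quanta: `a·b + c = 2^(m-1) + 5/8` quanta.
[this packet] -/
theorem not_dFma_of_equal_precision {φ ψ : Format} (hq : ψ.qexp + 1 ≤ φ.qexp)
    (hM : φ.maxScaled * 2 ^ (φ.qexp - ψ.qexp).toNat ≤ ψ.maxScaled)
    (hm : ψ.manBits = φ.manBits) (h2 : 2 ≤ φ.manBits) (hb1 : 1 ≤ φ.bias)
    (hb4 : 4 ≤ φ.bias + φ.manBits) (hN : 2 ^ (φ.manBits + 1) ≤ φ.maxScaled)
    (hp : 2 ^ (φ.bias + φ.manBits - 4) ≤ φ.maxScaled) : ¬ DFma φ ψ := by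
  intro hD
  have hq0 := φ.quantum_pos
  have hpow1 : 2 * 2 ^ (φ.manBits - 1) = 2 ^ φ.manBits := by
    rw [← pow_succ']; congr 1; omega
  have hpow2 : 2 ^ (φ.manBits + 1) = 2 * 2 ^ φ.manBits := pow_succ' 2 _
  have hm4 : 4 ≤ 2 ^ φ.manBits := by
    calc 4 = 2 ^ 2 := by norm_num
      _ ≤ 2 ^ φ.manBits := Nat.pow_le_pow_right (by norm_num) h2
  obtain ⟨a, ha⟩ := exists_toRat_eq_natMul
    (representable_of_lt_pow (φ := φ) (n := 5) (by omega) (by omega))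
  have hbR : φ.Representable (2 ^ (φ.bias + φ.manBits - 4)) := by
    simpa using
      representable_mul_pow (φ := φ) (k := 1) (j := φ.bias + φ.manBits - 4) (by omega)
        (by simpa using hp)
  obtain ⟨b, hb⟩ := exists_toRat_eq_natMul hbR
  obtain ⟨c, hc⟩ := exists_toRat_eq_natMul
    (representable_of_lt_pow (φ := φ) (n := 2 ^ (φ.manBits - 1)) (by omega) (by omega))
  have key : (2 : ℚ) ^ (φ.bias + φ.manBits - 4) * φ.quantum = 1 / 8 := by
    have h := two_pow_mul_quantum_eq_one hb1
    rw [show φ.manBits + (φ.bias - 1) = φ.bias + φ.manBits - 4 + 3 by omega, pow_add] at h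
    linarith
  have hsum : a.toRat * b.toRat + c.toRat
      = ((8 * 2 ^ (φ.manBits - 1) + 5 : ℕ) : ℚ) / 8 * φ.quantum := by
    rw [ha, hb, hc]
    push_cast
    have e1 : (5 : ℚ) * φ.quantum * ((2 : ℚ) ^ (φ.bias + φ.manBits - 4) * φ.quantum)
        = 5 * φ.quantum * (1 / 8) := by rw [key]
    rw [e1]; ring
  have hne := roundNE_roundNE_ne_half hq hM hm (by omega) (j := 2 ^ (φ.manBits - 1))
    (Nat.even_pow.mpr ⟨even_two, by omega⟩) (by omega) (by omega) (by omega)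
  rw [← hsum] at hne
  exact hne (hD a b c)

/-! ## §3 The named records: the seven equal-precision cells -/

/-- ON THE NAMED `13 × 13` MATRIX the hypothesis of THEOREM N-fma-E holds on exactly the `7`
equal-precision failing cells of `dFma_named_iff` (implementation A tabulates the same `7`; the
two equal-precision embedded pairs with EQUAL quanta, binary8p3 ⊆ binary8p3f and
binary8p4 ⊆ binary8p4f, are innocuous by clause G). [this packet] -/
theorem dFmaEqualPrecision_named_iff : ∀ X ∈ namedFormats, ∀ Y ∈ namedFormats,
    (Y.qexp + 1 ≤ X.qexp ∧ X.maxScaled * 2 ^ (X.qexp - Y.qexp).toNat ≤ Y.maxScaled ∧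
      Y.manBits = X.manBits ∧ 2 ≤ X.manBits ∧ 1 ≤ X.bias ∧ 4 ≤ X.bias + X.manBits ∧
      2 ^ (X.manBits + 1) ≤ X.maxScaled ∧ 2 ^ (X.bias + X.manBits - 4) ≤ X.maxScaled) ↔
    (X, Y) ∈ [(E3M2, E5M2), (E3M2, Binary8p3), (E3M2, Binary8p3F), (E2M3, E4M3),
      (E2M3, Binary8p4), (E2M3, Binary8p4F), (E5M2, Binary8p3F)] := by
  decide +kernel

/-- THE `7` EQUAL-PRECISION CELLS FAIL BY THE LAW (and are failing cells of the matrix,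
`∉ dFmaPairs`): e3m2 → e5m2 / binary8p3 / binary8p3f (`a·b + c = 5/16·1/8 + 1/8 = 21/128 ↦ 5/32
↦ 1/8` against `3/16`), e2m3 → e4m3 / binary8p4 / binary8p4f (`5/8·1/8 + 1/2 = 37/64 ↦ 9/16 ↦ 1/2`
against `5/8`), e5m2 → binary8p3f (`5·2^-16 · 2^-3 + 2^-15`). [this packet] -/
theorem dFmaEqualPrecision_cells : ∀ p ∈ [(E3M2, E5M2), (E3M2, Binary8p3), (E3M2, Binary8p3F),
    (E2M3, E4M3), (E2M3, Binary8p4), (E2M3, Binary8p4F), (E5M2, Binary8p3F)],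
    p ∉ dFmaPairs ∧ ¬ DFma p.1 p.2 := by
  intro p hp
  simp only [List.mem_cons, List.not_mem_nil, or_false] at hp
  rcases hp with rfl | rfl | rfl | rfl | rfl | rfl | rfl
  all_goals exact ⟨by decide +kernel, not_dFma_of_equal_precision (by decide +kernel)
    (by decide +kernel) (by decide +kernel) (by decide +kernel) (by decide +kernel)
    (by decide +kernel) (by decide +kernel) (by decide +kernel)⟩

/-! ## §4 Classification of the named matrix, completed -/

/-- CLASSIFICATION, COMPLETED.  Every failing cell `X ⊆ Y` (`embedsTest`, `∉ dFmaPairs`) of the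
named FMA matrix `dFma_named_iff` satisfies the hypothesis of THEOREM N-fma-E
(`not_dFma_of_equal_precision`, `7` cells), of THEOREM N-fma-A (`not_dFma_windowA`, `22` cells)
or of THEOREM N-fma-B (`not_dFma_windowB_canon`, `19` cells; `8` cells under both A and B): ALL
`40` failing embedded cells are instances of three record-generic laws, none is a searched
witness only; the `102` non-embedded pairs fail by `embeds_of_dFma_named`, and the `27` holding
cells hold by clauses (I)/(G)/(F) of `dFma_of_test`. [this packet] -/
theorem dFma_named_failing_classified : ∀ X ∈ namedFormats, ∀ Y ∈ namedFormats,
    embedsTest X Y = true → (X, Y) ∉ dFmaPairs →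
    (Y.qexp + 1 ≤ X.qexp ∧ X.maxScaled * 2 ^ (X.qexp - Y.qexp).toNat ≤ Y.maxScaled ∧
      Y.manBits = X.manBits ∧ 2 ≤ X.manBits ∧ 1 ≤ X.bias ∧ 4 ≤ X.bias + X.manBits ∧
      2 ^ (X.manBits + 1) ≤ X.maxScaled ∧ 2 ^ (X.bias + X.manBits - 4) ≤ X.maxScaled) ∨
    (Y.qexp ≤ X.qexp ∧ X.maxScaled * 2 ^ (X.qexp - Y.qexp).toNat ≤ Y.maxScaled ∧
      2 ≤ X.manBits ∧ 1 ≤ X.bias ∧ 2 ^ (X.manBits + X.bias + 1) ≤ X.maxScaled ∧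
      (X.manBits < Y.manBits ∧ 3 * 2 ^ (Y.manBits + 1) ≤ X.maxScaled ∨
        X.manBits + 2 ≤ Y.manBits ∧ 3 * 2 ^ Y.manBits ≤ X.maxScaled)) ∨
    (Y.qexp ≤ X.qexp ∧ X.maxScaled * 2 ^ (X.qexp - Y.qexp).toNat ≤ Y.maxScaled ∧
      1 ≤ X.manBits ∧ 1 ≤ X.bias ∧ X.bias ≤ Y.bias ∧ X.manBits < Y.manBits ∧
      ((Y.manBits - X.manBits) / 2 + 1 ≤ X.manBits ∧
        (2 ^ X.manBits + 1) *
            2 ^ (2 * ((Y.manBits - X.manBits) / 2) + 3 - (X.manBits + X.bias) + 1) ≤ X.maxScaled ∧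
        (2 ^ ((Y.manBits - X.manBits) / 2 + 1) - 1) *
            2 ^ (X.manBits + X.bias - (2 * ((Y.manBits - X.manBits) / 2) + 3)) ≤ X.maxScaled ∨
       (Y.manBits - X.manBits) % 2 = 0 ∧ (Y.manBits - X.manBits) / 2 ≤ X.manBits ∧
        (2 ^ X.manBits + 1) *
            2 ^ (Y.manBits - X.manBits + 1 - (X.manBits + X.bias) + 1) ≤ X.maxScaled ∧
        (2 ^ ((Y.manBits - X.manBits) / 2) - 1) *
            2 ^ (X.manBits + X.bias - (Y.manBits - X.manBits + 1)) ≤ X.maxScaled)) := by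
  decide +kernel

/-- THE THREE LAWS DECIDE EVERY NAMED CELL: `¬ DFma X Y` for every failing embedded cell, each by
the record-generic theorem its hypothesis selects (a corollary of `dFma_named_failing_classified`
with `not_dFma_of_equal_precision`, `not_dFma_windowA`, `not_dFma_windowB_canon`). [this packet] -/
theorem not_dFma_named_of_laws : ∀ X ∈ namedFormats, ∀ Y ∈ namedFormats,
    embedsTest X Y = true → (X, Y) ∉ dFmaPairs → ¬ DFma X Y := by
  intro X hX Y hY he hn
  rcases dFma_named_failing_classified X hX Y hY he hn with h | h | h
  · exact not_dFma_of_equal_precision h.1 h.2.1 h.2.2.1 h.2.2.2.1 h.2.2.2.2.1 h.2.2.2.2.2.1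
      h.2.2.2.2.2.2.1 h.2.2.2.2.2.2.2
  · exact not_dFma_windowA h
  · exact not_dFma_windowB_canon h

/-- READING, on the named matrix: an embedded pair with EQUAL precision is innocuous for the FMA
iff the quanta agree (the `13` diagonal cells and binary8p3 ⊆ binary8p3f, binary8p4 ⊆ binary8p4f
hold; the `7` pairs with a finer quantum fail). [this packet] -/
theorem dFma_named_equal_precision_iff_quantum : ∀ X ∈ namedFormats, ∀ Y ∈ namedFormats,
    embedsTest X Y = true → X.manBits = Y.manBits →
    ((X, Y) ∈ dFmaPairs ↔ X.qexp = Y.qexp) := by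
  decide +kernel

end Summit.Ventures.CertifiedArithmetic
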